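import Summits.HodgeConjecture.HodgeConjecture.Theorems.HodgeLocusCensusSchema
import Summits.HodgeConjecture.HodgeConjecture.Theorems.HodgeLocusCensusCubicRows
import HarnessLib
import HarnessLib.Audit.Tags
/-!
# HodgeLocusCensusSecondComponents — second components of V_δ through the Fermat cubic sixfold (cell pub-hlocus, referee gen 10/11, REFEREE.md R22–R24)
HONEST FRAMING: certified instances and evidence bearing on the general Hodge conjecture; no claim.

Cells (6,3,1) and (6,3,2), δ_λ = [P] + λ[P̌]. The referee's identification: inside a 2-plane Σ = {F + a g₀ + b g₁} of cubics which are
Sebastiani–Thom sums x_{v₀}³ + x_{v₁}³ + H_{a,b}(rest) (v = the vertex slot), the Hodge condition for δ_λ reduces to ONE equation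
(cone over the Noether–Lefschetz divisor of [π]+λ[π̌] on the cubic fourfold Y_{a,b} = V(H_{a,b}), h^{3,1}(Y) = 1; Kloosterman
arXiv:2312.12363 Thm 1.4 / Thm 5.3 mechanism), whose linear part is a combination of the FIRST-ORDER periods of P and P̌ along g₀, g₁.
What is typed AND PROVED here (kernel, no sorry) is exactly the first-order datum the referee certified mod two primes (R22 (a), R23 (iii)): the 2 × 2 matrix of
first-order periods of [P], [P̌] along (g₀, g₁) at the surviving row index has NONZERO determinant — equivalently the linear part of the
single equation is nonzero for EVERY λ, so the curve V_λ ∩ Σ is smooth for every λ and its tangent differs from those of V_{[P]} ∩ Σ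
and V_{[P̌]} ∩ Σ. The cone identification, the algebraicity along the curve (Zucker 1977 on Y_{a,b}) and the open status of the general
point of the second component are the cited evidence (COMPONENTS.md rows C4 / C2′), not part of these Props. Counting lemmas are `decide`.
-/
namespace Summit.HodgeConjecture.HodgeConjecture.HodgeLocus.Census

/-- first-order period of δ along the direction g = Σ_{j ∈ g} x^j (a polynomial deformation direction, e.g. a binomial) at row index i:
Σ_{j ∈ g} p_{i+j}(δ). -/
noncomputable def firstOrderAlong {K : Type*} [Field K] (n d : ℕ) (ζ : K) (δ : List (ℚ × LinearCycle n))
    (g : List (Fin (n+2) → ℕ)) (i : Fin (n+2) → ℕ) : K :=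
  (g.map fun j => periodComb n d ζ δ (fun e => i e + j e)).sum

/-- CONE-CURVE TANGENT CERTIFICATE (statement kind: per-cell): for the pair (P, P̌) and the 2-plane directions (g₀, g₁), the matrix
[[p(P; g₀), p(P; g₁)], [p(P̌; g₀), p(P̌; g₁)]] of first-order periods at the row index `i` has nonzero determinant over ℚ(ζ_{2d}).
Consequence (cited, not formalised): the linear part of the restricted Hodge equation of [P] + λ[P̌] is nonzero for every λ, and the
curve V_λ ∩ Σ is smooth and not contained in V_{[P]} (λ ≠ 0) nor in V_{[P̌]}. Characteristic zero only (R16 convention). -/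
def ConeTangentCert (n d : ℕ) (P Pc : LinearCycle n) (g₀ g₁ : List (Fin (n+2) → ℕ)) (i : Fin (n+2) → ℕ) : Prop :=
  ∀ (K : Type) [Field K] [CharZero K] (ζ : K), IsPrimitiveRoot ζ (2*d) →
    firstOrderAlong n d ζ [(1, P)] g₀ i * firstOrderAlong n d ζ [(1, Pc)] g₁ i
      - firstOrderAlong n d ζ [(1, P)] g₁ i * firstOrderAlong n d ζ [(1, Pc)] g₀ i ≠ 0

/-- exponent vector of a squarefree cubic monomial x_a x_b x_c on ℙ⁷ -/
def mono3 (a b c : Fin 8) : Fin 8 → ℕ := fun e => (if e = a then 1 else 0) + (if e = b then 1 else 0) + (if e = c then 1 else 0)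

/-- the row index x₀ (the surviving component on the vertex-(0,1) plane) -/
def rowX0 : Fin 8 → ℕ := fun e => if e = 0 then 1 else 0
/-- the row index x₂ (the surviving component on the vertex-(2,3) plane of (6,3,2)) -/
def rowX2 : Fin 8 → ℕ := fun e => if e = 2 then 1 else 0

/-- ζ a primitive 6th root of unity in a field of characteristic zero: ζ³ = −1 and ζ² = ζ − 1. -/
theorem primRoot6_facts {K : Type} [Field K] [CharZero K] (ζ : K) (hζ : IsPrimitiveRoot ζ (2*3)) :
    ζ ^ 6 = 1 ∧ ζ ^ 3 = -1 ∧ ζ ^ 2 = ζ - 1 := by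
  have h6 : ζ ^ 6 = 1 := hζ.pow_eq_one
  have h3 : ζ ^ 3 = -1 := by
    have hp : IsPrimitiveRoot (ζ ^ 3) 2 := hζ.pow (by norm_num) (by norm_num)
    exact hp.eq_neg_one_of_two_right
  have hne : ζ ≠ -1 := by
    intro h; have := hζ.pow_ne_one_of_pos_of_lt (by norm_num : (2:ℕ) ≠ 0) (by norm_num : 2 < 2*3)
    apply this; rw [h]; norm_num
  have hq : ζ ^ 2 = ζ - 1 := by
    have hf : (ζ + 1) * (ζ ^ 2 - ζ + 1) = 0 := by linear_combination h3
    rcases mul_eq_zero.1 hf with h | h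
    · exact absurd (by linear_combination h) hne
    · linear_combination h
  exact ⟨h6, h3, hq⟩


/-- (6,3,1), vertex (0,1): Σ = {F + a·(x₃x₅x₇ + x₃x₆x₇) + b·(x₃x₅x₆ + x₃x₄x₇)} (R22: c' ≠ −1, det = 2c'+2, two primes, order 16).
PROVED: the determinant is 4 − 2ζ (resp. −1 − ζ) after ζ⁶ = 1, ζ³ = −1, ζ² = ζ − 1, nonzero in characteristic zero; agrees with the exact ℤ[ζ₆] evaluation code/engineR/schema_cone_det.py. -/
theorem coneTangent_6_3_1_v01 :
  ConeTangentCert 6 3 (standardP 6) (standardPc 6 1 1)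
    [mono3 3 5 7, mono3 3 6 7] [mono3 3 5 6, mono3 3 4 7] rowX0 := by
  intro K _ _ ζ hζ
  simp only [firstOrderAlong, periodComb, period, standardP, standardPc, mono3, rowX0, List.map_cons, List.map_nil, List.sum_cons, List.sum_nil]
  simp [Fin.forall_fin_succ, Fin.sum_univ_succ]
  obtain ⟨h6, h3, hq⟩ := primRoot6_facts ζ hζ
  intro h
  have h12 : ζ ^ 12 = 1 := by rw [show (12:ℕ) = 6 * 2 by norm_num, pow_mul, h6, one_pow]
  have h9 : ζ ^ 9 = -1 := by rw [show (9:ℕ) = 6 + 3 by norm_num, pow_add, h6, h3]; ring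
  have h5 : ζ ^ 5 = -(ζ - 1) := by rw [show (5:ℕ) = 3 + 2 by norm_num, pow_add, h3, hq]; ring
  rw [h12, h9, h5, h6] at h
  have hz : ζ = 2 := by linear_combination (-1/2 : K) * h
  rw [hz] at hq; norm_num at hq

/-- (6,3,2), vertex (0,1): Σ₀₁ = {F + a·(x₃x₅x₇ + x₅x₆x₇) + b·(x₃x₅x₆ + x₄x₆x₇)} (R23: det = −(2c₀+1) ≠ 0, two primes, order 16).
PROVED: the determinant is 4 − 2ζ (resp. −1 − ζ) after ζ⁶ = 1, ζ³ = −1, ζ² = ζ − 1, nonzero in characteristic zero; agrees with the exact ℤ[ζ₆] evaluation code/engineR/schema_cone_det.py. -/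
theorem coneTangent_6_3_2_v01 :
  ConeTangentCert 6 3 (standardP 6) (standardPc 6 2 1)
    [mono3 3 5 7, mono3 5 6 7] [mono3 3 5 6, mono3 4 6 7] rowX0 := by
  intro K _ _ ζ hζ
  simp only [firstOrderAlong, periodComb, period, standardP, standardPc, mono3, rowX0, List.map_cons, List.map_nil, List.sum_cons, List.sum_nil]
  simp [Fin.forall_fin_succ, Fin.sum_univ_succ]
  obtain ⟨h6, h3, hq⟩ := primRoot6_facts ζ hζ
  intro h
  have h10 : ζ ^ 10 = -ζ := by rw [show (10:ℕ) = 6 + 3 + 1 by norm_num, pow_add, pow_add, h6, h3]; ring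
  have h7 : ζ ^ 7 = ζ := by rw [show (7:ℕ) = 6 + 1 by norm_num, pow_add, h6]; ring
  have h5 : ζ ^ 5 = -(ζ - 1) := by rw [show (5:ℕ) = 3 + 2 by norm_num, pow_add, h3, hq]; ring
  rw [h10, h7, h5, h6] at h
  have hz : ζ = -1 := by linear_combination (-1 : K) * h + hq
  rw [hz] at hq; norm_num at hq

/-- (6,3,2), vertex (2,3): Σ₂₃ = {F + a·(x₁x₅x₇ + x₄x₅x₇) + b·(x₁x₅x₆ + x₄x₅x₆)} (R23). PROVED: the determinant is 4 − 2ζ (resp. −1 − ζ) after ζ⁶ = 1, ζ³ = −1, ζ² = ζ − 1, nonzero in characteristic zero; agrees with the exact ℤ[ζ₆] evaluation code/engineR/schema_cone_det.py. -/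
theorem coneTangent_6_3_2_v23 :
  ConeTangentCert 6 3 (standardP 6) (standardPc 6 2 1)
    [mono3 1 5 7, mono3 4 5 7] [mono3 1 5 6, mono3 4 5 6] rowX2 := by
  intro K _ _ ζ hζ
  simp only [firstOrderAlong, periodComb, period, standardP, standardPc, mono3, rowX2, List.map_cons, List.map_nil, List.sum_cons, List.sum_nil]
  simp [Fin.forall_fin_succ, Fin.sum_univ_succ]
  obtain ⟨h6, h3, hq⟩ := primRoot6_facts ζ hζ
  intro h
  have h10 : ζ ^ 10 = -ζ := by rw [show (10:ℕ) = 6 + 3 + 1 by norm_num, pow_add, pow_add, h6, h3]; ring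
  have h7 : ζ ^ 7 = ζ := by rw [show (7:ℕ) = 6 + 1 by norm_num, pow_add, h6]; ring
  have h5 : ζ ^ 5 = -(ζ - 1) := by rw [show (5:ℕ) = 3 + 2 by norm_num, pow_add, h3, hq]; ring
  rw [h10, h7, h5, h6] at h
  have hz : ζ = -1 := by linear_combination (-1 : K) * h + hq
  rw [hz] at hq; norm_num at hq

/-! ## Counting lemmas (R22 (d)/(g), R23, R24 (ii)) -/

/-- primitive Hodge numbers of the cubic sixfold, h^{6−q,q}_prim = |R_{3(q+1)−8}| = C(8, 3(q+1)−8): (0,0,8,70,8,0,0), total 86. -/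
theorem cubicSixfold_hodgeNumbers :
    (List.range 7).map (fun q => if 3*(q+1) ≥ 8 ∧ 3*(q+1) - 8 ≤ 8 then Nat.choose 8 (3*(q+1) - 8) else 0)
      = [0, 0, 8, 70, 8, 0, 0] := by decide

/-- the Shioda–Katsura bookkeeping of R24 (ii): [H²_prim(S₁) ⊗ H⁴_prim(W)]^{μ₃} + H¹(E₀) ⊗ H³(T) = 3·11 + 3·11 + 2·10 = 86 = b₆,prim,
and h^{4,2} = 3 + 5 = 8. -/
theorem shiodaKatsura_count : 3 * 11 + 3 * 11 + 2 * 10 = 86 ∧ 3 + 5 = 8 := by decide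

/-- dimension bounds for components of V_δ through the Fermat cubic sixfold: 𝕋 has dimension 56, the Hodge condition is h^{4,2} = 8
equations, so every component has dimension ≥ 48; dim NL(pair) = 56 − intdim = 48 for (6,3,1) and 49 for (6,3,2). -/
theorem secondComponent_dimBounds :
    56 - 8 = 48 ∧ 56 - pairIncidenceCodim 3 1 = 48 ∧ 56 - pairIncidenceCodim 3 2 = 49 := by decide

/-- the cone (Eckardt-type) sublocus: cubic sixfolds with a hyperplane section that is a cone have codimension C(7,2) − 6 = 15 in 𝕋⁵⁶
(dimension 41); intersecting with the NL divisor of the fourfold leaves dimension 40 < 48 — the general point of the second component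
is NOT of cone type (OI-4 / OI-5). -/
theorem coneSublocus_dim : 56 - (Nat.choose 7 2 - 6) = 41 ∧ 41 - 1 = 40 ∧ 40 < 48 := by decide

/-! ## Referee gen 12 (R25): the Sebastiani–Thom cone curves of (6,3,0) and of the cubic EIGHTFOLD cells (8,3,2), (8,3,1)
Same certificate shape: the 2 × 2 first-order period matrix along (g₀, g₁) at the surviving row index has nonzero determinant over ℚ(ζ₆),
so the curve V_λ ∩ Σ is smooth for every λ and its tangent differs from those of V_{[P]} ∩ Σ and V_{[P̌]} ∩ Σ (R25 (b)/(c): two primes, order 16;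
the lead's exact ℚ(ζ₆) identity with the cubic-fourfold loci of the de-coned planes, orders 24/30). -/

/-- (6,3,0), vertex (0,1) (planes meeting in a POINT, c = 3): Σ = {F + a·(x₃x₅x₇ + x₃x₆x₇) + b·(x₃x₅x₆ + x₃x₄x₇)}, row x₀.
PROVED: p(P;g₀) = ζ⁵, p(P;g₁) = 2, p(P̌;g₀) = ζ¹¹, p(P̌;g₁) = 2ζ¹⁴, determinant 2ζ⁵(ζ² − 1) = 4ζ − 2 (after ζ⁶ = 1, ζ² = ζ − 1) ≠ 0 in characteristic zero. -/
theorem coneTangent_6_3_0_v01 :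
  ConeTangentCert 6 3 (standardP 6) (standardPc 6 0 1)
    [mono3 3 5 7, mono3 3 6 7] [mono3 3 5 6, mono3 3 4 7] rowX0 := by
  intro K _ _ ζ hζ
  simp only [firstOrderAlong, periodComb, period, standardP, standardPc, mono3, rowX0, List.map_cons, List.map_nil, List.sum_cons, List.sum_nil]
  simp [Fin.forall_fin_succ, Fin.sum_univ_succ]
  obtain ⟨h6, h3, hq⟩ := primRoot6_facts ζ hζ
  intro h
  have h14 : ζ ^ 14 = ζ ^ 2 := by rw [show (14:ℕ) = 6 * 2 + 2 by norm_num, pow_add, pow_mul, h6]; ring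
  have h11 : ζ ^ 11 = -(ζ ^ 2) := by rw [show (11:ℕ) = 6 + 3 + 2 by norm_num, pow_add, pow_add, h6, h3]; ring
  have h5 : ζ ^ 5 = -(ζ ^ 2) := by rw [show (5:ℕ) = 3 + 2 by norm_num, pow_add, h3]; ring
  rw [h14, h11, h5, h6] at h
  rw [hq] at h
  have hz : ζ = 1/2 := by linear_combination (1/4 : K) * h + (1/2 : K) * hq
  rw [hz] at hq; norm_num at hq

/-- exponent vector of a squarefree cubic monomial x_a x_b x_c on ℙ⁹ (eightfolds) -/
def mono3' (a b c : Fin 10) : Fin 10 → ℕ := fun e => (if e = a then 1 else 0) + (if e = b then 1 else 0) + (if e = c then 1 else 0)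
/-- the row index x₁x₃ (degree (n/2)d − n − 2 = 2 for n = 8, d = 3; a surviving component on the doubly-coned plane) -/
def rowX1X3 : Fin 10 → ℕ := fun e => if e = 1 then 1 else if e = 3 then 1 else 0

/-- (8,3,2) (planes sharing slots (0,1),(2,3); c = 2): Σ = {F₈ + a·(x₅x₇x₉ + x₅x₈x₉) + b·(x₅x₇x₈ + x₅x₆x₉)}, row x₁x₃.
PROVED: p(P;g₀) = ζ⁵, p(P;g₁) = 2, p(P̌;g₀) = ζ⁹ = −1, p(P̌;g₁) = 2ζ¹² = 2, determinant 2ζ⁵ + 2 = 4 − 2ζ ≠ 0. -/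
theorem coneTangent_8_3_2_v01 :
  ConeTangentCert 8 3 (standardP 8) (standardPc 8 2 1)
    [mono3' 5 7 9, mono3' 5 8 9] [mono3' 5 7 8, mono3' 5 6 9] rowX1X3 := by
  intro K _ _ ζ hζ
  simp only [firstOrderAlong, periodComb, period, standardP, standardPc, mono3', rowX1X3, List.map_cons, List.map_nil, List.sum_cons, List.sum_nil]
  simp [Fin.forall_fin_succ, Fin.sum_univ_succ]
  obtain ⟨h6, h3, hq⟩ := primRoot6_facts ζ hζ
  intro h
  have h12 : ζ ^ 12 = 1 := by rw [show (12:ℕ) = 6 * 2 by norm_num, pow_mul, h6, one_pow]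
  have h9 : ζ ^ 9 = -1 := by rw [show (9:ℕ) = 6 + 3 by norm_num, pow_add, h6, h3]; ring
  have h5 : ζ ^ 5 = -(ζ - 1) := by rw [show (5:ℕ) = 3 + 2 by norm_num, pow_add, h3, hq]; ring
  rw [h12, h9, h5, h6] at h
  have hz : ζ = 2 := by linear_combination (-1/2 : K) * h
  rw [hz] at hq; norm_num at hq

/-- (8,3,1) (planes sharing slot (0,1) only; c = 3): same Σ, row x₁x₃.
PROVED: p(P̌;g₀) = ζ¹¹, p(P̌;g₁) = 2ζ¹⁴, determinant 2ζ⁵(ζ² − 1) = 4ζ − 2 ≠ 0 (the (6,3,0) pattern one k up). -/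
theorem coneTangent_8_3_1_v01 :
  ConeTangentCert 8 3 (standardP 8) (standardPc 8 1 1)
    [mono3' 5 7 9, mono3' 5 8 9] [mono3' 5 7 8, mono3' 5 6 9] rowX1X3 := by
  intro K _ _ ζ hζ
  simp only [firstOrderAlong, periodComb, period, standardP, standardPc, mono3', rowX1X3, List.map_cons, List.map_nil, List.sum_cons, List.sum_nil]
  simp [Fin.forall_fin_succ, Fin.sum_univ_succ]
  obtain ⟨h6, h3, hq⟩ := primRoot6_facts ζ hζ
  intro h
  have h14 : ζ ^ 14 = ζ ^ 2 := by rw [show (14:ℕ) = 6 * 2 + 2 by norm_num, pow_add, pow_mul, h6]; ring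
  have h11 : ζ ^ 11 = -(ζ ^ 2) := by rw [show (11:ℕ) = 6 + 3 + 2 by norm_num, pow_add, pow_add, h6, h3]; ring
  have h5 : ζ ^ 5 = -(ζ ^ 2) := by rw [show (5:ℕ) = 3 + 2 by norm_num, pow_add, h3]; ring
  rw [h14, h11, h5, h6] at h
  rw [hq] at h
  have hz : ζ = 1/2 := by linear_combination (1/4 : K) * h + (1/2 : K) * hq
  rw [hz] at hq; norm_num at hq

/-- dimension bookkeeping for the eightfold cells (R25 (e)): the deformation slice 𝕋 = I₃ (squarefree cubics in 10 variables) has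
|I₃| = C(10,3) = 120, the Hodge equations number h^{5,3}_prim = |I₂| = C(10,2) = 45, so every component of V_δ through X_F has
dimension ≥ 120 − 45 = 75 (Krull), and dim NL(pair) = 120 − pairIncidenceCodim 4 m. -/
theorem eightfold_dimBounds : Nat.choose 10 3 = 120 ∧ Nat.choose 10 2 = 45 ∧ 120 - 45 = 75 := by decide

end Summit.HodgeConjecture.HodgeConjecture.HodgeLocus.Census
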